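import Mathlib.Combinatorics.SimpleGraph.Walk.Counting
import Mathlib.Combinatorics.SimpleGraph.Paths
import Mathlib.Combinatorics.SimpleGraph.Operations
import Mathlib.Topology.Algebra.InfiniteSum.ENNReal
import Summits.CriticalPhenomena.SAWScalingLimit.Theorems.SAWTotalPositivityBoundaryTP2Defs
import Summits.CriticalPhenomena.SAWScalingLimit.Theorems.SAWTotalPositivityBoundaryTP2Kernel
import Summits.CriticalPhenomena.SAWScalingLimit.Theorems.SAWTotalPositivityBoundaryTP2Symmetry
import Summits.CriticalPhenomena.SAWScalingLimit.Theorems.SAWTotalPositivityBoundaryTP2FirstStep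
import Summits.CriticalPhenomena.SAWScalingLimit.Theorems.SAWTotalPositivityBoundaryTP2Avoid
import Summits.CriticalPhenomena.SAWScalingLimit.Theorems.SAWTotalPositivityBoundaryTP2SquareGadget
import HarnessLib

/-!
# Crux `LeftRightFKG` (stmt-CriticalPhenomena-11232), line `corner-localisation` (v8): the chain gadget

Registered stub `stub_chainGadget` of the skeleton v8. For `0 < x < 1`, the combinatorial core
`GraphTP2At x` of the sibling crux `BoundaryTP2` (TP₂ of the fugacity-`x` self-avoiding path kernel on
every finite subgraph of `ℤ²`), together with the degree-2 visiting identity (stub `stub_visitDeg2`, taken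
here as a HYPOTHESIS), gives the **three-point inequality**

  `Z_H(c,a) · Z_H(c,b) ≤ Z_H(a,b)`

for pairwise distinct `c, a, b`, an `H`-isolated vertex `p` lattice-adjacent to `c` and to `b`, under the
realisability conditions "`a, b` connected in `H − c`" and "`a, c` connected in `H − b`".

Proof (the *chain gadget*): hang the two lattice edges `c p`, `p b` on `H`, obtaining
`H' = H ⊔ edge c p ⊔ edge p b ≤ ℤ²`, in which `N(p) = {b, c}` and `H' − p = H`. The quadruple `(b, a, c, p)`
of `H'` is interlaced (the last step of a path into `p` comes from `b` or from `c`) and both nested pairings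
are realised disjointly (an `H − c` path `b → a` with the edge `c p`; the edge `b p` with an `H − b` path
`a → c`), so the core gives `Z'(b,c) Z'(a,p) ≤ Z'(b,a) Z'(c,p)`. First-step decompositions at `p` and the
visiting identity evaluate `Z'(p,c) = x (Z(b,c) + 1)`, `Z'(p,a) = x (Z(b,a) + Z(c,a))`,
`Z'(b,c) = x² + Z(b,c)`, `Z'(b,a) ≤ x² Z(c,a) + Z(b,a)`; in terms of `α = Z(c,a)`, `β = Z(c,b)`,
`γ = Z(a,b)` the inequality reads `(x² + β) · x (γ + α) ≤ (x² α + γ) · x (β + 1)`, i.e.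
`(1 − x²)(α β − γ) ≤ 0`, whence `α β ≤ γ`. Template: `BoundaryTP2.pathKernel_le_one_of_graphTP2At`
(the square gadget). Everything here is proved. [folklore]
-/

noncomputable section
open Literature.Probability.LatticeModels
open Summit.CriticalPhenomena.SAWScalingLimit.Theorems.BoundaryTP2
open scoped ENNReal

namespace Summit.CriticalPhenomena.SAWScalingLimit.Theorems.LeftRightFKG.CornerGadget

variable {V : Type*}

/-- A reachability witness of the vertex-deleted graph `G − c`, started at `u ≠ c`, yields a self-avoiding
path of any supergraph `H' ≥ G` that avoids `c` and whose vertices are `u` or non-isolated vertices of `G`.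
[folklore] -/
private theorem exists_path_of_reachable_deleteVert [DecidableEq V] {G H' : SimpleGraph V}
    (hle : G ≤ H') {c u v : V} (h : (G.deleteEdges (G.incidenceSet c)).Reachable u v) (hu : u ≠ c) :
    ∃ P : H'.Path u v, c ∉ P.1.support ∧ ∀ w ∈ P.1.support, w = u ∨ w ∈ G.support := by
  obtain ⟨W⟩ := h
  have hGc : G.deleteEdges (G.incidenceSet c) ≤ H' := (SimpleGraph.deleteEdges_le _).trans hle
  have hmem : ∀ w ∈ W.support, w = u ∨ w ∈ G.support := by
    intro w hw
    rcases mem_support_walk W w hw with h | h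
    · exact Or.inl h
    · exact Or.inr (SimpleGraph.support_mono (SimpleGraph.deleteEdges_le _) h)
  have hc : c ∉ W.support := by
    intro hcW
    rcases mem_support_walk W c hcW with h | h
    · exact hu h.symm
    · obtain ⟨z, hz⟩ := (SimpleGraph.mem_support _).1 h
      exact ((deleteEdges_incidenceSet_adj G c c z).1 hz).2.1 rfl
  refine ⟨⟨W.bypass.mapLe hGc, W.bypass_isPath.mapLe hGc⟩, ?_, ?_⟩
  · rw [SimpleGraph.Walk.support_mapLe_eq_support]
    exact fun h => hc (W.support_bypass_subset_support h)
  · intro w hw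
    rw [SimpleGraph.Walk.support_mapLe_eq_support] at hw
    exact hmem w (W.support_bypass_subset_support hw)

/-- The real-algebra step of the chain gadget: for `0 < x < 1`,
`(x² + β) · x (γ + α) ≤ (x² α + γ) · x (β + 1)` is `(1 − x²)(α β − γ) ≤ 0`, hence `α β ≤ γ`. [folklore] -/
private theorem real_step {x α β γ : ℝ} (hx0 : 0 < x) (hx1 : x < 1)
    (h : (x ^ 2 + β) * (x * (γ + α)) ≤ (x ^ 2 * α + γ) * (x * (β + 1))) : α * β ≤ γ := by
  have e1 : (x ^ 2 + β) * (x * (γ + α)) = x * ((x ^ 2 + β) * (γ + α)) := by ring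
  have e2 : (x ^ 2 * α + γ) * (x * (β + 1)) = x * ((x ^ 2 * α + γ) * (β + 1)) := by ring
  rw [e1, e2] at h
  have h2 : (x ^ 2 + β) * (γ + α) ≤ (x ^ 2 * α + γ) * (β + 1) := le_of_mul_le_mul_left h hx0
  have h3 : (1 - x ^ 2) * (α * β) ≤ (1 - x ^ 2) * γ := by nlinarith [h2]
  have hpos : 0 < 1 - x ^ 2 := by nlinarith
  exact le_of_mul_le_mul_left h3 hpos

/-- The passage from `ℝ≥0∞` to `ℝ` in the chain gadget: the gadget inequality between `ofReal`-kernels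
forces `α β ≤ γ`. [folklore] -/
private theorem ennreal_step {x α β γ : ℝ} (hx0 : 0 < x) (hx1 : x < 1) (hα : 0 ≤ α) (hβ : 0 ≤ β)
    (hγ : 0 ≤ γ)
    (h : (ENNReal.ofReal (x ^ 2) + ENNReal.ofReal β) *
        (ENNReal.ofReal x * (ENNReal.ofReal γ + ENNReal.ofReal α)) ≤
      (ENNReal.ofReal (x ^ 2) * ENNReal.ofReal α + ENNReal.ofReal γ) *
        (ENNReal.ofReal x * (ENNReal.ofReal β + 1))) :
    ENNReal.ofReal α * ENNReal.ofReal β ≤ ENNReal.ofReal γ := by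
  have hx : 0 ≤ x := hx0.le
  have hx2 : 0 ≤ x ^ 2 := pow_nonneg hx 2
  have eL : (ENNReal.ofReal (x ^ 2) + ENNReal.ofReal β) *
      (ENNReal.ofReal x * (ENNReal.ofReal γ + ENNReal.ofReal α)) =
        ENNReal.ofReal ((x ^ 2 + β) * (x * (γ + α))) := by
    rw [ENNReal.ofReal_mul (add_nonneg hx2 hβ), ENNReal.ofReal_add hx2 hβ, ENNReal.ofReal_mul hx,
      ENNReal.ofReal_add hγ hα]
  have eR : (ENNReal.ofReal (x ^ 2) * ENNReal.ofReal α + ENNReal.ofReal γ) *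
      (ENNReal.ofReal x * (ENNReal.ofReal β + 1)) =
        ENNReal.ofReal ((x ^ 2 * α + γ) * (x * (β + 1))) := by
    rw [ENNReal.ofReal_mul (add_nonneg (mul_nonneg hx2 hα) hγ),
      ENNReal.ofReal_add (mul_nonneg hx2 hα) hγ, ENNReal.ofReal_mul hx2, ENNReal.ofReal_mul hx,
      ENNReal.ofReal_add hβ zero_le_one, ENNReal.ofReal_one]
  rw [eL, eR, ENNReal.ofReal_le_ofReal_iff (by positivity)] at h
  rw [← ENNReal.ofReal_mul hα]
  exact ENNReal.ofReal_le_ofReal (real_step hx0 hx1 h)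

/-- **The chain gadget** (registered stub `stub_chainGadget` of the line `corner-localisation`, v8). For
`0 < x < 1`, the core `GraphTP2At x` and the degree-2 visiting identity (the statement of stub
`stub_visitDeg2`, a hypothesis here) give, for every `H ≤ ℤ²` with finitely many non-isolated vertices,
pairwise distinct `c, a, b`, an `H`-isolated `p` lattice-adjacent to `c` and `b`, with `a, b` connected in
`H − c` and `a, c` connected in `H − b`: `Z_H(c,a) Z_H(c,b) ≤ Z_H(a,b)`. See the module docstring for the
proof (hang `c p b`, apply the core to `(b, a, c, p)`, evaluate the four kernels, cancel `1 − x² > 0`).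
[folklore] -/
theorem stub_chainGadget : ∀ x : ℝ, 0 < x → x < 1 → GraphTP2At x →
    (∀ (G : SimpleGraph (Site 2)) (x : ℝ) (c s r t : Site 2), 0 ≤ x →
      G.neighborSet c = {s, r} → s ≠ r → t ≠ c → t ≠ s →
      pathKernelOn G x s t {γ | c ∈ γ.1.support} =
        ENNReal.ofReal (x ^ 2) * pathKernel (G.deleteEdges (G.incidenceSet c ∪ G.incidenceSet s)) x r t) →
    ∀ (H : SimpleGraph (Site 2)), H ≤ zdGraph 2 → H.support.Finite →
    ∀ c a b p : Site 2, c ≠ a → c ≠ b → a ≠ b → p ∉ H.support → (zdGraph 2).Adj c p → (zdGraph 2).Adj p b →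
      (H.deleteEdges (H.incidenceSet c)).Reachable a b → (H.deleteEdges (H.incidenceSet b)).Reachable a c →
      pathKernel H x c a * pathKernel H x c b ≤ pathKernel H x a b := by
  intro x hx0 hx1 h hV H hH hfin c a b p hca hcb hab hp hcp hpb hRab hRac
  classical
  have hxle : 0 ≤ x := hx0.le
  -- the three marked vertices carry edges of `H`; `p` does not
  have hne : ∀ {u v : Site 2}, u ∈ H.support → v ∉ H.support → u ≠ v :=
    fun hu hv huv => hv (huv ▸ hu)
  have hsuppD : ∀ {z u v : Site 2}, (H.deleteEdges (H.incidenceSet z)).Adj u v → u ∈ H.support :=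
    fun h => ⟨_, SimpleGraph.deleteEdges_le _ h⟩
  obtain ⟨Wab⟩ := hRab
  obtain ⟨Wac⟩ := hRac
  have ha_supp : a ∈ H.support := by
    obtain ⟨u, hu⟩ := exists_adj_of_walk_ne Wab hab
    exact hsuppD hu
  have hb_supp : b ∈ H.support := by
    obtain ⟨u, hu⟩ := exists_adj_of_walk_ne Wab.reverse hab.symm
    exact hsuppD hu
  have hc_supp : c ∈ H.support := by
    obtain ⟨u, hu⟩ := exists_adj_of_walk_ne Wac.reverse hca
    exact hsuppD hu
  have hap : a ≠ p := hne ha_supp hp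
  have hbp : b ≠ p := hne hb_supp hp
  have hcp_ne : c ≠ p := hne hc_supp hp
  have hHp : ∀ z, ¬ H.Adj p z := fun z hz => hp ⟨z, hz⟩
  -- the gadget graph `H' = H ⊔ cp ⊔ pb`
  obtain ⟨H', hH'⟩ : ∃ H' : SimpleGraph (Site 2),
      H' = H ⊔ SimpleGraph.edge c p ⊔ SimpleGraph.edge p b := ⟨_, rfl⟩
  have hadj : ∀ u v, H'.Adj u v ↔ H.Adj u v ∨ ((u = c ∧ v = p ∨ u = p ∧ v = c) ∧ u ≠ v) ∨
      ((u = p ∧ v = b ∨ u = b ∧ v = p) ∧ u ≠ v) := by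
    intro u v
    rw [hH']
    simp only [SimpleGraph.sup_adj, SimpleGraph.edge_adj, or_assoc]
  have hle : H ≤ H' := by rw [hH']; exact le_sup_left.trans le_sup_left
  have hH'zd : H' ≤ zdGraph 2 := by
    rw [hH']
    refine sup_le (sup_le hH ?_) ?_
    · exact (SimpleGraph.edge_le_iff _).2 (Or.inr hcp)
    · exact (SimpleGraph.edge_le_iff _).2 (Or.inr hpb)
  have hH'cp : H'.Adj c p := (hadj c p).2 (Or.inr (Or.inl ⟨Or.inl ⟨rfl, rfl⟩, hcp_ne⟩))
  have hH'pb : H'.Adj p b := (hadj p b).2 (Or.inr (Or.inr ⟨Or.inl ⟨rfl, rfl⟩, hbp.symm⟩))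
  -- the neighbourhood of `p` in `H'`
  have hNp : ∀ z, H'.Adj p z ↔ z = b ∨ z = c := by
    intro z
    constructor
    · intro hz
      rcases (hadj p z).1 hz with hz | ⟨h', -⟩ | ⟨h', -⟩
      · exact (hHp z hz).elim
      · rcases h' with ⟨h1, -⟩ | ⟨-, h2⟩
        · exact absurd h1.symm hcp_ne
        · exact Or.inr h2
      · rcases h' with ⟨-, h2⟩ | ⟨h1, -⟩
        · exact Or.inl h2
        · exact absurd h1.symm hbp
    · rintro (rfl | rfl)
      · exact hH'pb
      · exact hH'cp.symm
  have hN : H'.neighborSet p = {b, c} := by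
    ext z
    rw [SimpleGraph.mem_neighborSet, hNp z, Set.mem_insert_iff, Set.mem_singleton_iff]
  -- `H'` has finitely many non-isolated vertices
  have hH'fin : H'.support.Finite := by
    refine (hfin.union (((Set.finite_singleton b).insert p).insert c)).subset ?_
    rintro u ⟨v, huv⟩
    rcases (hadj u v).1 huv with h' | ⟨h', -⟩ | ⟨h', -⟩
    · exact Or.inl ⟨v, h'⟩
    · right; rcases h' with ⟨rfl, -⟩ | ⟨rfl, -⟩ <;> simp
    · right; rcases h' with ⟨rfl, -⟩ | ⟨rfl, -⟩ <;> simp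
  -- deleting `p` from `H'` gives back `H`; deleting `p` and `b` gives a subgraph of `H`
  have hHp' : H'.deleteEdges (H'.incidenceSet p) = H := by
    ext u v
    rw [deleteEdges_incidenceSet_adj, hadj]
    constructor
    · rintro ⟨h' | ⟨h', -⟩ | ⟨h', -⟩, hup, hvp⟩
      · exact h'
      · rcases h' with ⟨-, h2⟩ | ⟨h1, -⟩
        · exact absurd h2 hvp
        · exact absurd h1 hup
      · rcases h' with ⟨h1, -⟩ | ⟨-, h2⟩
        · exact absurd h1 hup
        · exact absurd h2 hvp
    · intro huv
      exact ⟨Or.inl huv, hne ⟨v, huv⟩ hp, hne ⟨u, huv.symm⟩ hp⟩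
  have hle2 : H'.deleteEdges (H'.incidenceSet p ∪ H'.incidenceSet b) ≤ H :=
    (SimpleGraph.deleteEdges_anti Set.subset_union_left).trans hHp'.le
  -- the four gadget kernels
  have K1 : pathKernel H' x p c = ENNReal.ofReal x * (pathKernel H x b c + 1) := by
    rw [pathKernel_firstStep_pair H' x hxle hcp_ne.symm hcb.symm hN, hHp', pathKernel_self]
  have K2 : pathKernel H' x p a = ENNReal.ofReal x * (pathKernel H x b a + pathKernel H x c a) := by
    rw [pathKernel_firstStep_pair H' x hxle hap.symm hcb.symm hN, hHp']
  have K3 : pathKernel H' x b c = ENNReal.ofReal (x ^ 2) + pathKernel H x b c := by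
    rw [← pathKernelOn_add_compl x b c {γ : H'.Path b c | p ∈ γ.1.support},
      hV H' x p b c c hxle hN hcb.symm hcp_ne hcb, pathKernel_self, mul_one, Set.compl_setOf,
      stub_pathKernelOn_avoid H' x b c p hbp hcp_ne, hHp']
  have K4 : pathKernel H' x b a ≤ ENNReal.ofReal (x ^ 2) * pathKernel H x c a + pathKernel H x b a := by
    rw [← pathKernelOn_add_compl x b a {γ : H'.Path b a | p ∈ γ.1.support},
      hV H' x p b c a hxle hN hcb.symm hap hab, Set.compl_setOf,
      stub_pathKernelOn_avoid H' x b a p hbp hap, hHp']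
    exact add_le_add_left (mul_le_mul_right (pathKernel_mono hle2 x c a) _) _
  -- hypotheses of the core for the quadruple `(b, a, c, p)` of `H'`
  have hI : Interlaced H' b a c p := by
    intro P Q
    obtain ⟨v, hadj', q, hq⟩ := SimpleGraph.Walk.exists_eq_cons_of_ne hap.symm Q.1.reverse
    have hvQ : v ∈ Q.1.support := by
      have hmem : v ∈ Q.1.reverse.support := by
        rw [hq, SimpleGraph.Walk.support_cons]
        exact List.mem_cons_of_mem _ q.start_mem_support
      rwa [SimpleGraph.Walk.support_reverse, List.mem_reverse] at hmem
    rcases (hNp v).1 hadj' with rfl | rfl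
    · exact ⟨_, P.1.start_mem_support, hvQ⟩
    · exact ⟨_, P.1.end_mem_support, hvQ⟩
  have hD1 : DisjointPaths H' b a c p := by
    obtain ⟨P, hPc, hPmem⟩ := exists_path_of_reachable_deleteVert hle ⟨Wab⟩ hca.symm
    refine ⟨⟨P.1.reverse, P.2.reverse⟩, SimpleGraph.Path.singleton hH'cp, ?_⟩
    simp only [SimpleGraph.Path.singleton_coe, SimpleGraph.Walk.support_cons,
      SimpleGraph.Walk.support_nil, SimpleGraph.Walk.support_reverse]
    intro v hv hv'
    simp only [List.mem_reverse, List.mem_cons, List.not_mem_nil, or_false] at hv hv'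
    rcases hv' with rfl | rfl
    · exact hPc hv
    · rcases hPmem _ hv with h' | h'
      · exact hap h'.symm
      · exact hp h'
  have hD2 : DisjointPaths H' b p a c := by
    obtain ⟨Q, hQb, hQmem⟩ := exists_path_of_reachable_deleteVert hle ⟨Wac⟩ hab
    refine ⟨SimpleGraph.Path.singleton hH'pb.symm, Q, ?_⟩
    simp only [SimpleGraph.Path.singleton_coe, SimpleGraph.Walk.support_cons,
      SimpleGraph.Walk.support_nil]
    intro v hv hv'
    simp only [List.mem_cons, List.not_mem_nil, or_false] at hv
    rcases hv with rfl | rfl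
    · exact hQb hv'
    · rcases hQmem _ hv' with h' | h'
      · exact hap h'.symm
      · exact hp h'
  -- apply the core and evaluate
  have key := h H' hH'zd hH'fin b a c p hI hD1 hD2
  have key2 : (ENNReal.ofReal (x ^ 2) + pathKernel H x b c) *
      (ENNReal.ofReal x * (pathKernel H x b a + pathKernel H x c a)) ≤
        (ENNReal.ofReal (x ^ 2) * pathKernel H x c a + pathKernel H x b a) *
          (ENNReal.ofReal x * (pathKernel H x b c + 1)) := by
    calc (ENNReal.ofReal (x ^ 2) + pathKernel H x b c) *
          (ENNReal.ofReal x * (pathKernel H x b a + pathKernel H x c a))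
        = pathKernel H' x b c * pathKernel H' x a p := by rw [K3, pathKernel_comm H' x a p, K2]
      _ ≤ pathKernel H' x b a * pathKernel H' x c p := key
      _ ≤ _ := by
          rw [pathKernel_comm H' x c p, K1]
          exact mul_le_mul_left K4 _
  -- pass to real numbers
  obtain ⟨α, hα0, hα⟩ : ∃ α : ℝ, 0 ≤ α ∧ pathKernel H x c a = ENNReal.ofReal α :=
    ⟨_, ENNReal.toReal_nonneg, (ENNReal.ofReal_toReal (pathKernel_ne_top hfin x c a)).symm⟩
  obtain ⟨β, hβ0, hβ⟩ : ∃ β : ℝ, 0 ≤ β ∧ pathKernel H x c b = ENNReal.ofReal β :=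
    ⟨_, ENNReal.toReal_nonneg, (ENNReal.ofReal_toReal (pathKernel_ne_top hfin x c b)).symm⟩
  obtain ⟨γ, hγ0, hγ⟩ : ∃ γ : ℝ, 0 ≤ γ ∧ pathKernel H x a b = ENNReal.ofReal γ :=
    ⟨_, ENNReal.toReal_nonneg, (ENNReal.ofReal_toReal (pathKernel_ne_top hfin x a b)).symm⟩
  rw [pathKernel_comm H x b c, pathKernel_comm H x b a, hα, hβ, hγ] at key2
  rw [hα, hβ, hγ]
  exact ennreal_step hx0 hx1 hα0 hβ0 hγ0 key2

end Summit.CriticalPhenomena.SAWScalingLimit.Theorems.LeftRightFKG.CornerGadget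

end
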